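import Summits.HubbardSuperconductivity.HubbardSuperconductivity.Theses.InfiniteVolumeFirst

/-!
# Strategist sketch — crux `NoInfraredPileUp` (stmt-HubbardSuperconductivity-18534), route InfiniteVolumeFirst

Typed objects referred to by `STRATEGY-CENSUS.md` (crux-strategist seat
planner-cstrat-stmt-HubbardSuperconductivity-18534-b1-0, 2026-08-17). Everything here elaborates;
the two glue theorems are sorry-free. Nothing in this file is filed as an item.

* §D  `NoSlidingCondensate` (Sub₁) / `AtomSuppressesPileUp` (Sub₂) and the PROVED split glue
      `noInfraredPileUp_of_subs : Sub₁ → Sub₂ → NoInfraredPileUp` (the best typed decomposition);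
* §R1 `TightnessExchangeVanishing` (exchange lemma consuming only Sub₁) and the PROVED re-glue
      `closes_of_noSlidingCondensate : NoNormalLimitState → Sub₁ → TightnessExchangeVanishing → S`;
* §N  `PileUpForcesLimitAtom` (model-free converse harmonic analysis: a non-tight family has a
      torus-limit with a positive condensate atom — provable now from landed Fejér-majorant lemmas);
* §S  strengthenings `UniformFlatWindow` (S⁺₂) and the coarse kinematic ceiling `WeakCouplingPairCeiling`
      (provable now; per-mode, NOT a window bound).
-/

namespace Summit.HubbardSuperconductivity.HubbardSuperconductivity.Cruxes.NoInfraredPileUp.Strategist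

open Summit.HubbardSuperconductivity.HubbardSuperconductivity.Theses.InfiniteVolumeFirst
open Literature.MathematicalPhysics.QuantumLattice Literature.Probability.LatticeModels Matrix Finset Filter

/-! ### §D  The atom / no-atom split -/

/-- Sub₁ — NO SLIDING CONDENSATE: at weak coupling, for every admissible ground-state family and
every `η > 0` there is a zero-mode threshold `θ > 0` and a window `ε` such that, eventually along
the even sides, a SMALL zero mode (`S_L(0) ≤ θ L²`) forces a tight window (`Σ_{0<|q_m|≤ε} S_L(m) ≤ η L²`).
This is the half of the crux the route's exchange actually consumes (the bad subsequence of
`TightnessExchange` has `S_L(0)/L² → 0`). Refutation surface: FF/LO-type condensates at pair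
momentum `2πk/L`, fragmented condensates — NOT phase separation with a coherent paired component
(that has `S_L(0) ≥ θL²`). Still behind the twist wall (`WallSoft.lean`). -/
def NoSlidingCondensate : Prop :=
  ∀ δ ∈ Set.Ioo (0:ℝ) (1 / 2), ∃ U₁ : ℝ, 0 < U₁ ∧ ∀ U ∈ Set.Ioo (0:ℝ) U₁,
    ∀ (N : ℕ → ℕ) (ψ : ∀ L, Fock (Orb (FermionTorus 2 L))),
      (∀ L, Even L → N L = 2 * ⌊(1 - δ) * (L : ℝ) ^ 2 / 2⌋₊ ∧ star (ψ L) ⬝ᵥ ψ L = 1 ∧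
          IsGroundStateInSector (hubbardTorus 2 L 1 U) (N L) 0 (ψ L)) →
        ∀ η : ℝ, 0 < η → ∃ θ : ℝ, 0 < θ ∧ ∃ ε : ℝ, 0 < ε ∧ ∃ L₀ : ℕ, ∀ (L : ℕ) [NeZero L],
          Even L → L₀ ≤ L →
            pairStructureFactor dWaveFormFactor L (ψ L) 0 ≤ θ * (L : ℝ) ^ 2 →
              (∑ m : Fin 2 → ZMod L, if m ≠ 0 ∧ momentumNormSq L m ≤ ε ^ 2 then
                  pairStructureFactor dWaveFormFactor L (ψ L) m else 0) ≤ η * (L : ℝ) ^ 2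

/-- Sub₂ — A MACROSCOPIC ZERO MODE LEAVES A TIGHT WINDOW (Nozières anti-fragmentation at weak
coupling): for every admissible family, every zero-mode floor `θ > 0` and every `η > 0` there are
`ε, L₀` such that eventually `S_L(0) ≥ θ L²` forces `Σ_{0<|q_m|≤ε} S_L(m) ≤ η L²`. Dead weight for the
route (never used along the bad subsequence); behind the same twist wall (superpositions of a
ground state with its LSM twist). -/
def AtomSuppressesPileUp : Prop :=
  ∀ δ ∈ Set.Ioo (0:ℝ) (1 / 2), ∃ U₁ : ℝ, 0 < U₁ ∧ ∀ U ∈ Set.Ioo (0:ℝ) U₁,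
    ∀ (N : ℕ → ℕ) (ψ : ∀ L, Fock (Orb (FermionTorus 2 L))),
      (∀ L, Even L → N L = 2 * ⌊(1 - δ) * (L : ℝ) ^ 2 / 2⌋₊ ∧ star (ψ L) ⬝ᵥ ψ L = 1 ∧
          IsGroundStateInSector (hubbardTorus 2 L 1 U) (N L) 0 (ψ L)) →
        ∀ θ : ℝ, 0 < θ → ∀ η : ℝ, 0 < η → ∃ ε : ℝ, 0 < ε ∧ ∃ L₀ : ℕ, ∀ (L : ℕ) [NeZero L],
          Even L → L₀ ≤ L →
            θ * (L : ℝ) ^ 2 ≤ pairStructureFactor dWaveFormFactor L (ψ L) 0 →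
              (∑ m : Fin 2 → ZMod L, if m ≠ 0 ∧ momentumNormSq L m ≤ ε ^ 2 then
                  pairStructureFactor dWaveFormFactor L (ψ L) m else 0) ≤ η * (L : ℝ) ^ 2

/-- The window sum is monotone in the window radius (nonnegative summands). [folklore] -/
theorem windowSum_mono {L : ℕ} [NeZero L] (φ : Fock (Orb (FermionTorus 2 L))) {ε ε' : ℝ}
    (hε : 0 ≤ ε) (h : ε ≤ ε') :
    (∑ m : Fin 2 → ZMod L, if m ≠ 0 ∧ momentumNormSq L m ≤ ε ^ 2 then
        pairStructureFactor dWaveFormFactor L φ m else 0) ≤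
      (∑ m : Fin 2 → ZMod L, if m ≠ 0 ∧ momentumNormSq L m ≤ ε' ^ 2 then
        pairStructureFactor dWaveFormFactor L φ m else 0) := by
  refine Finset.sum_le_sum fun m _ => ?_
  have hsq : ε ^ 2 ≤ ε' ^ 2 := by nlinarith
  by_cases h1 : m ≠ 0 ∧ momentumNormSq L m ≤ ε ^ 2
  · rw [if_pos h1, if_pos ⟨h1.1, h1.2.trans hsq⟩]
  · rw [if_neg h1]
    split_ifs
    · exact pairStructureFactor_nonneg _ _ _ _
    · exact le_rfl

/-- **The split glue, proved**: Sub₁ and Sub₂ together give the crux (case split on the zero mode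
at each side; `U₁ := min`, `ε := min`, `L₀ := max`). [folklore] -/
theorem noInfraredPileUp_of_subs (h1 : NoSlidingCondensate) (h2 : AtomSuppressesPileUp) :
    NoInfraredPileUp := by
  intro δ hδ
  obtain ⟨U₁, hU₁, hA⟩ := h1 δ hδ
  obtain ⟨U₂, hU₂, hB⟩ := h2 δ hδ
  refine ⟨min U₁ U₂, lt_min hU₁ hU₂, fun U hU N ψ hadm η hη => ?_⟩
  have hUA : U ∈ Set.Ioo (0:ℝ) U₁ := ⟨hU.1, hU.2.trans_le (min_le_left _ _)⟩
  have hUB : U ∈ Set.Ioo (0:ℝ) U₂ := ⟨hU.1, hU.2.trans_le (min_le_right _ _)⟩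
  obtain ⟨θ, hθ, ε₁, hε₁, L₁, hL₁⟩ := hA U hUA N ψ hadm η hη
  obtain ⟨ε₂, hε₂, L₂, hL₂⟩ := hB U hUB N ψ hadm θ hθ η hη
  refine ⟨min ε₁ ε₂, lt_min hε₁ hε₂, max L₁ L₂, fun L _ hL hL₀ => ?_⟩
  by_cases hz : pairStructureFactor dWaveFormFactor L (ψ L) 0 ≤ θ * (L : ℝ) ^ 2
  · exact (windowSum_mono (ψ L) (le_min hε₁.le hε₂.le) (min_le_left _ _)).trans
      (hL₁ L hL ((le_max_left _ _).trans hL₀) hz)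
  · exact (windowSum_mono (ψ L) (le_min hε₁.le hε₂.le) (min_le_right _ _)).trans
      (hL₂ L hL ((le_max_right _ _).trans hL₀) (le_of_lt (not_le.1 hz)))

/-! ### §R1  The exchange lemma that consumes only Sub₁, and the re-glued deciding theorem -/

/-- `TightnessExchange` with the tightness hypothesis weakened to the Sub₁ shape (tight windows only
when the zero mode is below a threshold). Provable now by a 15-line modification of the landed
`infiniteVolumeFirst_tightnessExchange_proof`: the hypothesis is invoked only along the bad
subsequence, where `LRO_L = S_L(0)/L² → 0`. -/
def TightnessExchangeVanishing : Prop :=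
  ∀ (ψ : ∀ L, Fock (Orb (FermionTorus 2 L))), (∀ L, Even L → star (ψ L) ⬝ᵥ ψ L = 1) →
    (∀ η : ℝ, 0 < η → ∃ θ : ℝ, 0 < θ ∧ ∃ ε : ℝ, 0 < ε ∧ ∃ L₀ : ℕ, ∀ (L : ℕ) [NeZero L],
        Even L → L₀ ≤ L → pairStructureFactor dWaveFormFactor L (ψ L) 0 ≤ θ * (L : ℝ) ^ 2 →
          (∑ m : Fin 2 → ZMod L, if m ≠ 0 ∧ momentumNormSq L m ≤ ε ^ 2 then
              pairStructureFactor dWaveFormFactor L (ψ L) m else 0) ≤ η * (L : ℝ) ^ 2) →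
      (∀ (Ls : ℕ → ℕ) (C : Site 2 → ℝ), StrictMono Ls → (∀ j, Even (Ls j)) →
          (∀ x : Site 2, Tendsto (fun j : ℕ => (∑ y ∈ halfOpenBox 2 (Ls j),
              torusPullback (pairFieldCorr dWaveFormFactor ψ) (Ls j) (x + y) y) / ((Ls j : ℕ) : ℝ) ^ 2)
            atTop (nhds (C x))) →
            0 < liminf (fun R : ℕ => (∑ x ∈ halfOpenBox 2 R, ∑ y ∈ halfOpenBox 2 R, C (x - y)) /
              ((R : ℕ) : ℝ) ^ 4) atTop) →
        HasLongRangeOrder (fun k => halfOpenBox 2 (2 * k))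
          (fun k => torusPullback (pairFieldCorr dWaveFormFactor ψ) (2 * k))

/-- **R1, certified**: with Sub₁ in place of the crux and the vanishing-mode exchange lemma in
place of `TightnessExchange`, the route's deciding theorem is the same five lines of logic.
[folklore] -/
theorem closes_of_noSlidingCondensate (h1 : NoNormalLimitState) (h2 : NoSlidingCondensate)
    (h3 : TightnessExchangeVanishing) : _root_.HubbardSuperconductivity := by
  obtain ⟨δ, hδ, h1'⟩ := h1
  obtain ⟨U₁, hU₁, h2'⟩ := h2 δ hδ
  obtain ⟨U, hU, hA⟩ := h1' U₁ hU₁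
  refine ⟨U, hU.1, δ, hδ, fun N ψ hadm => ?_⟩
  exact h3 ψ (fun L hL => (hadm L hL).2.1) (h2' U hU N ψ hadm) (hA N ψ hadm)

/-! ### §N  Negation: a counterexample is an infinite-volume condensate -/

/-- PILE-UP FORCES A LIMIT ATOM (model-free, provable now): for ANY family of torus vectors
normalised at even sides, if the window tails are NOT tight then along some strictly increasing
sequence of even sides the translation-averaged `d`-wave pair correlations converge pointwise to a
limit with a strictly positive condensate atom. Inputs: `windowSum_le_fejerMajorant`
(`Σ_{m≠0,|q_m|≤ε} S ≤ 16 (T_R/R² − S(0))`, εR ≤ 1, landed p138360), monotonicity of the window in ε,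
and the diagonal compactness of `infiniteVolumeFirst_tightnessExchange_proof` (no Bochner theorem:
choosing the k-th bad side bad for the window ε_k makes it bad for every ε ≥ ε_k, hence the block order
at every scale R ≤ 1/ε_k is ≥ η/16, and the bound passes to the pointwise limit for every fixed R). Consequence: ¬NoInfraredPileUp ⇒ at some δ, in
EVERY coupling interval (0,U₁), some admissible ground-state family has a torus-limit with d-wave
ODLRO — refuting the crux means PROVING weak-coupling infinite-volume pair condensation. -/
def PileUpForcesLimitAtom : Prop :=
  ∀ (ψ : ∀ L, Fock (Orb (FermionTorus 2 L))), (∀ L, Even L → star (ψ L) ⬝ᵥ ψ L = 1) →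
    ¬ (∀ η : ℝ, 0 < η → ∃ ε : ℝ, 0 < ε ∧ ∃ L₀ : ℕ, ∀ (L : ℕ) [NeZero L], Even L → L₀ ≤ L →
        (∑ m : Fin 2 → ZMod L, if m ≠ 0 ∧ momentumNormSq L m ≤ ε ^ 2 then
            pairStructureFactor dWaveFormFactor L (ψ L) m else 0) ≤ η * (L : ℝ) ^ 2) →
      ∃ (Ls : ℕ → ℕ) (C : Site 2 → ℝ), StrictMono Ls ∧ (∀ j, Even (Ls j)) ∧
        (∀ x : Site 2, Tendsto (fun j : ℕ => (∑ y ∈ halfOpenBox 2 (Ls j),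
            torusPullback (pairFieldCorr dWaveFormFactor ψ) (Ls j) (x + y) y) / ((Ls j : ℕ) : ℝ) ^ 2)
          atTop (nhds (C x))) ∧
        0 < liminf (fun R : ℕ => (∑ x ∈ halfOpenBox 2 R, ∑ y ∈ halfOpenBox 2 R, C (x - y)) /
          ((R : ℕ) : ℝ) ^ 4) atTop

/-- ALL-NORMAL ⇒ TIGHT (corollary shape of `PileUpForcesLimitAtom`, per family): if every
torus-limit of a normalised family has zero condensate atom, its windows are tight. So the crux is
AUTOMATIC wherever the route's rank-2 crux `NoNormalLimitState` fails totally, and wall-hard exactly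
where the route is alive. -/
def AllNormalImpliesTight : Prop :=
  ∀ (ψ : ∀ L, Fock (Orb (FermionTorus 2 L))), (∀ L, Even L → star (ψ L) ⬝ᵥ ψ L = 1) →
    (∀ (Ls : ℕ → ℕ) (C : Site 2 → ℝ), StrictMono Ls → (∀ j, Even (Ls j)) →
        (∀ x : Site 2, Tendsto (fun j : ℕ => (∑ y ∈ halfOpenBox 2 (Ls j),
            torusPullback (pairFieldCorr dWaveFormFactor ψ) (Ls j) (x + y) y) / ((Ls j : ℕ) : ℝ) ^ 2)
          atTop (nhds (C x))) →
          liminf (fun R : ℕ => (∑ x ∈ halfOpenBox 2 R, ∑ y ∈ halfOpenBox 2 R, C (x - y)) /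
            ((R : ℕ) : ℝ) ^ 4) atTop ≤ 0) →
      ∀ η : ℝ, 0 < η → ∃ ε : ℝ, 0 < ε ∧ ∃ L₀ : ℕ, ∀ (L : ℕ) [NeZero L], Even L → L₀ ≤ L →
        (∑ m : Fin 2 → ZMod L, if m ≠ 0 ∧ momentumNormSq L m ≤ ε ^ 2 then
            pairStructureFactor dWaveFormFactor L (ψ L) m else 0) ≤ η * (L : ℝ) ^ 2

/-- The corollary is pure logic from `PileUpForcesLimitAtom`. [folklore] -/
theorem allNormalImpliesTight_of (h : PileUpForcesLimitAtom) : AllNormalImpliesTight := by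
  intro ψ hψ hnormal
  by_contra hnt
  obtain ⟨Ls, C, hLs, hev, hconv, hatom⟩ := h ψ hψ hnt
  exact absurd (hnormal Ls C hLs hev hconv) (not_le.2 hatom)

/-! ### §S  Strengthenings -/

/-- S⁺₂ — UNIFORM FLAT WINDOW: a uniform bound on every nonzero mode. Implies the crux with room
(window `≤ C·#{0<|q_m|≤ε} ≈ C ε²L²/(4π)`), true at `U = 0` over the whole degenerate Slater ground
space (Wick + shell counting), but FALSE in kind wherever the ground state has `d`-wave LRO with a
linearly dispersing phase mode (`S(q_min) ~ m² c L/(4πρ_s)` grows like `L`); recorded, not pursued. -/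
def UniformFlatWindow : Prop :=
  ∀ δ ∈ Set.Ioo (0:ℝ) (1 / 2), ∃ U₁ : ℝ, 0 < U₁ ∧ ∃ C : ℝ, ∀ U ∈ Set.Ioo (0:ℝ) U₁,
    ∃ L₀ : ℕ, ∀ (L : ℕ) [NeZero L], Even L → L₀ ≤ L →
      ∀ ψ : Fock (Orb (FermionTorus 2 L)), star ψ ⬝ᵥ ψ = 1 →
        IsGroundStateInSector (hubbardTorus 2 L 1 U) (2 * ⌊(1 - δ) * (L : ℝ) ^ 2 / 2⌋₊) 0 ψ →
          ∀ m : Fin 2 → ZMod L, m ≠ 0 → pairStructureFactor dWaveFormFactor L ψ m ≤ C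

/-- Flat ⇒ crux is NOT claimed here (it needs the window-cardinality count); recorded as the
obvious implication for the census. -/
example : True := trivial

/-- WEAK-COUPLING PAIR CEILING (kinematic; provable now, ~1.5 k Lean lines): there is `C = C(δ)`
such that every normalised `(N_L, 0)`-sector ground state at coupling `U ∈ (0,1]` has
`S_ψ(m) ≤ C (U^{2/5} L² + 1)` at EVERY momentum label `m` (zero mode included: `d`-wave pair LRO
density `≤ C U^{2/5}`). Proof sketch: `‖Δ_d(m)ψ‖² ≤ 32 N + (4 Σ_k w_k)²`,
`w_k = (n_{k↑}(1−n_{k↑}))^{1/4}` (Cauchy–Schwarz both ways on `⟨b_k† b_{k'}⟩`, pair operators on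
disjoint modes commute); `n(1−n) ≤ |n_k − n_k^{FS}|`; the excess free kinetic energy of a repulsive
ground state is `≤ U L²/2` (variational principle against the free Slater ground state, `U D ≥ 0`);
Hölder + a Fermi-shell lattice count `#{k : |ε_k − ε_F| < τ} ≤ C(τL² + L)` (δ ∈ (0,1/2) keeps ε_F
off the van Hove level). PER-MODE only: it does NOT bound the window SUM (N_ε ≈ ε²L²/4π modes),
hence does not touch the crux; it calibrates the route (every limit atom is `≤ C U^{2/5}`). -/
def WeakCouplingPairCeiling : Prop :=
  ∀ δ ∈ Set.Ioo (0:ℝ) (1 / 2), ∃ C : ℝ, ∃ L₁ : ℕ, ∀ U ∈ Set.Ioc (0:ℝ) 1, ∀ (L : ℕ) [NeZero L],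
    L₁ ≤ L → ∀ ψ : Fock (Orb (FermionTorus 2 L)), star ψ ⬝ᵥ ψ = 1 →
      IsGroundStateInSector (hubbardTorus 2 L 1 U) (2 * ⌊(1 - δ) * (L : ℝ) ^ 2 / 2⌋₊) 0 ψ →
        ∀ m : Fin 2 → ZMod L,
          pairStructureFactor dWaveFormFactor L ψ m ≤ C * (U ^ ((2:ℝ) / 5) * (L : ℝ) ^ 2 + 1)

end Summit.HubbardSuperconductivity.HubbardSuperconductivity.Cruxes.NoInfraredPileUp.Strategist
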